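import Summits.RiemannHypothesis.RiemannHypothesis.Theorems.GroundBartaEvenWinsBeyondArchDeflationWeightedCore
import Summits.RiemannHypothesis.RiemannHypothesis.Theorems.GroundBartaEvenWinsBeyondArchDeflationWeightedTransfer
import Summits.RiemannHypothesis.RiemannHypothesis.Theorems.GroundBartaEvenWinsBeyondArchDeflationRitz
import HarnessLib

/-!
# RiemannHypothesis / GroundBarta — rung 4 (`EvenWinsBeyondArch`, stmt-RiemannHypothesis-18807 / 18085):
# the deflated Temple L-side with a WEIGHTED complement level — sector bound and the odd bottom from Ritz data

Helper file (`--supports stmt-RiemannHypothesis-18085`), RH-free, no definitions, no named facts.  Prover A (gen 4 of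
unit `sr-gb-rung-a`).

Weighted analogues of `dt_sector_bound` (file IV), `dt_sector_bound_of_ritz` and `dt_weilOddGroundEnergy_ge_of_ritz`
(file IX): the complement certificate has a POINTWISE level, `∫ n|φ|² + λ∫|φ|² ≤ Re Q(φ) + Σ μ_i|∫φ v̄_i|²` on smooth sector
tests (`n ≥ 0` bounded measurable, `w = 1/n` bounded), and the finite datum is `A − λG − R_w ⪰ 0` with the WEIGHTED residual
Gram matrix `R_w,ij = ∫ w · Re(r_i r̄_j)`.  Use: the refined three-prime sliver (`n + λ = β₂₃ − (log 2)/2 · 𝟙_{|y| ≥ y₁}`,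
`y₁ ≤ log 4 − c`) charges the interior residual mass only `1/(β₂₃ − λ)`.
-/

set_option linter.dupNamespace false

noncomputable section

open MeasureTheory Set Filter
open scoped Topology ENNReal NNReal ComplexConjugate BigOperators

namespace Summit.RiemannHypothesis.RiemannHypothesis.Theorems.EvenWinsBeyondArch

open Literature.NumberTheory.LFunctions Literature.NumberTheory.LFunctions.ConnesVanSuijlekom
open Summit.RiemannHypothesis.RiemannHypothesis.Theorems.OddSector
  (weilIncrement₂ weilDirichletEnergy₂ weilPoleForm₂ weilIncrement₂_self weilDirichletEnergy₂_self
    weilPoleForm₂_self re_mul_conj_self isWeilTest_rePart isWeilTest_imPart tsupport_rePart_subset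
    tsupport_imPart_subset integral_norm_sq_rePart_add_imPart re_weilQuadratic_eq_rePart_add_imPart)

/-- **Weighted deflated Temple bound on smooth sector tests (parity `σ`).**  Inputs as `dt_sector_bound` except: the
certificate has the pointwise level `n + λ` (`n ≥ 0` measurable, `|n|, |w| ≤ C`, `w ≥ 0`, `w n = 1`) and the PSD datum
is `A − λG − R_w ⪰ 0`.  Conclusion: `λ ∫|g|² ≤ Re Q(g)` for every smooth test `g` supported in `[-c, c]` with
`g(-x) = σ g(x)`. [cite: WeinsteinStenger1972, Ch. 5 §9 eq. (2) (k = 1: Temple's formula)] -/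
theorem dt_sector_bound_w {c : ℝ} (hc : 0 < c) (σ : ℝ) {k : ℕ} (v F : Fin k → ℝ → ℂ)
    (W : Fin k → Fin k → ℝ) (μ : Fin k → ℝ) (lam : ℝ) (hμ : ∀ i, 0 ≤ μ i)
    {n w : ℝ → ℝ} (hnm : Measurable n) (hwm : Measurable w) {C : ℝ} (hnC : ∀ y, |n y| ≤ C) (hwC : ∀ y, |w y| ≤ C)
    (hn0 : ∀ y, 0 ≤ n y) (hw0 : ∀ y, 0 ≤ w y) (hwn : ∀ y, w y * n y = 1)
    (hv : ∀ i, MemLp (v i) 2 ∧ (∀ x, x ∉ Icc (-c) c → v i x = 0) ∧ (∀ x, (v i x).im = 0) ∧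
      (∀ x, v i (-x) = (σ : ℂ) * v i x) ∧
      IntegrableOn (fun t ↦ weilArchDensity t * weilIncrement (v i) t) (Ioi 0))
    (hF : ∀ i, MemLp (F i) 2)
    (hrepr : ∀ i (f : ℝ → ℂ), MemLp f 2 → (∀ x, x ∉ Icc (-c) c → f x = 0) → (∀ x, (f x).im = 0) →
      (∀ x, f (-x) = (σ : ℂ) * f x) →
      IntegrableOn (fun t ↦ weilArchDensity t * weilIncrement f t) (Ioi 0) →
      weilPoleForm₂ (v i) f + weilDirichletEnergy₂ c (v i) f -
          weilMarkovConstant c * ∫ x, (v i x * conj (f x)).re = ∫ x, (F i x * conj (f x)).re)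
    (hcert : ∀ φ : ℝ → ℂ, IsWeilTest φ → tsupport φ ⊆ Icc (-c) c → (∀ x, φ (-x) = (σ : ℂ) * φ x) →
      (∫ y, n y * ‖φ y‖ ^ 2) + lam * ∫ x, ‖φ x‖ ^ 2 ≤
        (weilQuadratic φ).re + ∑ i, μ i * ‖∫ x, φ x * conj (v i x)‖ ^ 2)
    (hPSD : ∀ α : Fin k → ℝ, 0 ≤ ∑ i, ∑ j, α i * α j *
      ((weilPoleForm₂ (v i) (v j) + weilDirichletEnergy₂ c (v i) (v j) -
          weilMarkovConstant c * ∫ x, (v i x * conj (v j x)).re) - lam * (∫ x, (v i x * conj (v j x)).re) -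
        ∫ y, w y * ((F i - ∑ l, W i l • v l) y * conj ((F j - ∑ l, W j l • v l) y)).re))
    {g : ℝ → ℂ} (hg : IsWeilTest g) (hgs : tsupport g ⊆ Icc (-c) c)
    (hgp : ∀ x, g (-x) = (σ : ℂ) * g x) :
    lam * ∫ x, ‖g x‖ ^ 2 ≤ (weilQuadratic g).re := by
  -- the weighted complement bound on the sector form domain, transferred from the certificate
  have hbeta : ∀ h : ℝ → ℂ, MemLp h 2 → (∀ x, x ∉ Icc (-c) c → h x = 0) → (∀ x, (h x).im = 0) →
      (∀ x, h (-x) = (σ : ℂ) * h x) →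
      IntegrableOn (fun t ↦ weilArchDensity t * weilIncrement h t) (Ioi 0) →
      (∀ j, ∫ x, (v j x * conj (h x)).re = 0) →
      (∫ y, n y * ‖h y‖ ^ 2) + lam * ∫ x, ‖h x‖ ^ 2 ≤
        weilPoleForm h + weilDirichletEnergy c h - weilMarkovConstant c * ∫ x, ‖h x‖ ^ 2 := by
    intro h hh hhs hhr hhp hhE h0
    exact dt_beta_transfer_w hc (σ : ℂ) v (fun i ↦ (hv i).1) μ hμ lam hnm hnC hn0 hcert hh hhs hhp hhE
      fun i ↦ dt_integral_mul_conj_eq_zero_of_real hh (hv i).1 hhr (hv i).2.2.1 (h0 i)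
  -- the bound for REAL sector tests in the window
  have hreal : ∀ r : ℝ → ℂ, IsWeilTest r → tsupport r ⊆ Icc (-c) c → (∀ x, (r x).im = 0) →
      (∀ x, r (-x) = (σ : ℂ) * r x) → lam * ∫ x, ‖r x‖ ^ 2 ≤ (weilQuadratic r).re := by
    intro r hr hrs hrr hrp
    have hrs' : ∀ x, x ∉ Icc (-c) c → r x = 0 := fun x hx ↦
      image_eq_zero_of_notMem_tsupport fun hm ↦ hx (hrs hm)
    have h := dt_deflation_core_w (σ : ℂ) v F W lam hnm hwm hnC hwC hn0 hw0 hwn hv hF hrepr hbeta hPSD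
      hr.memLp_two hrs' hrr hrp (integrableOn_weilArchDensity_mul_weilIncrement hr)
    rwa [← weilQuadratic_re_eq_weilPoleForm_add_weilDirichletEnergy_sub hr hrs] at h
  -- split `g` into real and imaginary parts
  set gR : ℝ → ℂ := fun x ↦ ((g x).re : ℂ) with hgR
  set gI : ℝ → ℂ := fun x ↦ ((g x).im : ℂ) with hgI
  have hR := hreal gR (isWeilTest_rePart hg) ((tsupport_rePart_subset g).trans hgs)
    (fun x ↦ by simp [hgR]) (fun x ↦ by simp [hgR, hgp x])
  have hI := hreal gI (isWeilTest_imPart hg) ((tsupport_imPart_subset g).trans hgs)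
    (fun x ↦ by simp [hgI]) (fun x ↦ by simp [hgI, hgp x])
  rw [re_weilQuadratic_eq_rePart_add_imPart hg, ← integral_norm_sq_rePart_add_imPart hg.memLp_two]
  simp only [hgR, hgI] at hR hI
  linarith

/-- **The weighted deflated Temple bound from `C²` × indicator Ritz data, parity `σ`.**  As `dt_sector_bound_of_ritz`
with the pointwise complement level and the weighted residual Gram matrix. [cite: WeinsteinStenger1972, Ch. 5 §9 eq. (2) (k = 1: Temple's formula)] -/
theorem dt_sector_bound_of_ritz_w {c : ℝ} (hc : 0 < c) (σ : ℝ) {k : ℕ}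
    (g : Fin k → ℝ → ℝ) (hg : ∀ i, ContDiff ℝ 2 (g i)) (hgp : ∀ i x, g i (-x) = σ * g i x)
    (v F : Fin k → ℝ → ℂ) (hv : ∀ i x, v i x = (((Icc (-c) c).indicator (g i) x : ℝ) : ℂ))
    (hF : ∀ i y, F i y = (Icc (-c) c).indicator (fun y ↦
        2 * (∫ x, v i x * (Real.cosh (x / 2) : ℂ)) * (Real.cosh (y / 2) : ℂ) -
          2 * (∫ x, v i x * (Real.sinh (x / 2) : ℂ)) * (Real.sinh (y / 2) : ℂ) +
        (∑ n ∈ weilPrimeIndex c, (((ArithmeticFunction.vonMangoldt n : ℝ) / Real.sqrt n : ℝ) : ℂ) *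
          (2 * v i y - v i (y - Real.log n) - v i (y + Real.log n))) +
        ∫ t in Ioi 0, (weilArchDensity t : ℂ) * (2 * v i y - v i (y - t) - v i (y + t))) y -
      (weilMarkovConstant c : ℂ) * v i y)
    (W : Fin k → Fin k → ℝ) (μ : Fin k → ℝ) (lam : ℝ) (hμ : ∀ i, 0 ≤ μ i)
    {n w : ℝ → ℝ} (hnm : Measurable n) (hwm : Measurable w) {C : ℝ} (hnC : ∀ y, |n y| ≤ C) (hwC : ∀ y, |w y| ≤ C)
    (hn0 : ∀ y, 0 ≤ n y) (hw0 : ∀ y, 0 ≤ w y) (hwn : ∀ y, w y * n y = 1)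
    (hcert : ∀ φ : ℝ → ℂ, IsWeilTest φ → tsupport φ ⊆ Icc (-c) c → (∀ x, φ (-x) = (σ : ℂ) * φ x) →
      (∫ y, n y * ‖φ y‖ ^ 2) + lam * ∫ x, ‖φ x‖ ^ 2 ≤
        (weilQuadratic φ).re + ∑ i, μ i * ‖∫ x, φ x * conj (v i x)‖ ^ 2)
    (hPSD : ∀ α : Fin k → ℝ, 0 ≤ ∑ i, ∑ j, α i * α j *
      ((weilPoleForm₂ (v i) (v j) + weilDirichletEnergy₂ c (v i) (v j) -
          weilMarkovConstant c * ∫ x, (v i x * conj (v j x)).re) - lam * (∫ x, (v i x * conj (v j x)).re) -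
        ∫ y, w y * ((F i - ∑ l, W i l • v l) y * conj ((F j - ∑ l, W j l • v l) y)).re))
    {φ : ℝ → ℂ} (hφ : IsWeilTest φ) (hφs : tsupport φ ⊆ Icc (-c) c) (hφp : ∀ x, φ (-x) = (σ : ℂ) * φ x) :
    lam * ∫ x, ‖φ x‖ ^ 2 ≤ (weilQuadratic φ).re := by
  have hveq : ∀ i, v i = fun x ↦ (((Icc (-c) c).indicator (g i) x : ℝ) : ℂ) := fun i ↦ funext (hv i)
  -- the trial vectors lie in the sector form domain (as in file IX)
  have hvD : ∀ i, MemLp (v i) 2 ∧ (∀ x, x ∉ Icc (-c) c → v i x = 0) ∧ (∀ x, (v i x).im = 0) ∧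
      (∀ x, v i (-x) = (σ : ℂ) * v i x) ∧
      IntegrableOn (fun t ↦ weilArchDensity t * weilIncrement (v i) t) (Ioi 0) := by
    intro i
    obtain ⟨h1, h2, h3, h4⟩ := dt_indicator_mul_mem_formDomain hc ((hg i).of_le (by norm_num))
    refine ⟨by rw [hveq i]; exact h1, fun x hx ↦ by rw [hv i x]; exact h2 x hx,
      fun x ↦ by rw [hv i x]; exact h3 x, fun x ↦ ?_, by rw [hveq i]; exact h4⟩
    rw [hv i, hv i]
    have hsym : (-x ∈ Icc (-c) c) ↔ (x ∈ Icc (-c) c) := by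
      simp only [mem_Icc]; constructor <;> rintro ⟨h₁, h₂⟩ <;> constructor <;> linarith
    by_cases hx : x ∈ Icc (-c) c
    · rw [indicator_of_mem (hsym.2 hx), indicator_of_mem hx, hgp i x]; push_cast; ring
    · rw [indicator_of_notMem (fun h ↦ hx (hsym.1 h)), indicator_of_notMem hx]; simp
  have hmaj : ∀ i, ∃ m : ℝ → ℝ, MemLp m 2 volume ∧
      (∀ y ∈ Ioo (-c) c,
        IntegrableOn (fun t ↦ weilArchDensity t * ‖2 * v i y - v i (y - t) - v i (y + t)‖) (Ioi 0)) ∧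
      (∀ y ∈ Ioo (-c) c,
        ∫ t in Ioi 0, weilArchDensity t * ‖2 * v i y - v i (y - t) - v i (y + t)‖ ≤ m y) :=
    fun i ↦ dt_exists_majorant_of_contDiff hc (hg i) (hv i)
  have hFm : ∀ i, MemLp (F i) 2 := by
    intro i
    obtain ⟨m, hm, _, hHm⟩ := hmaj i
    exact dt_windowImage_memLp (hvD i).1 hm hHm (hF i)
  have hrepr : ∀ i (f : ℝ → ℂ), MemLp f 2 → (∀ x, x ∉ Icc (-c) c → f x = 0) → (∀ x, (f x).im = 0) →
      (∀ x, f (-x) = (σ : ℂ) * f x) →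
      IntegrableOn (fun t ↦ weilArchDensity t * weilIncrement f t) (Ioi 0) →
      weilPoleForm₂ (v i) f + weilDirichletEnergy₂ c (v i) f -
          weilMarkovConstant c * ∫ x, (v i x * conj (f x)).re = ∫ x, (F i x * conj (f x)).re := by
    intro i f hf hfs _ _ _
    obtain ⟨m, hm, hHi, hHm⟩ := hmaj i
    exact dt_windowImage_repr (hvD i).1 hm hHi hHm (hF i) hf hfs
  exact dt_sector_bound_w hc σ v F W μ lam hμ hnm hwm hnC hwC hn0 hw0 hwn hvD hFm hrepr hcert hPSD hφ hφs hφp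

/-- **Weighted deflated Temple lower bound for `ε_od(c)` from odd `C²` × indicator Ritz data**:
`λ ≤ weilOddGroundEnergy c`. [cite: WeinsteinStenger1972, Ch. 5 §9 eq. (2) (k = 1: Temple's formula)] -/
theorem dt_weilOddGroundEnergy_ge_of_ritz_w {c : ℝ} (hc : 0 < c) {k : ℕ}
    (g : Fin k → ℝ → ℝ) (hg : ∀ i, ContDiff ℝ 2 (g i)) (hgo : ∀ i x, g i (-x) = -g i x)
    (v F : Fin k → ℝ → ℂ) (hv : ∀ i x, v i x = (((Icc (-c) c).indicator (g i) x : ℝ) : ℂ))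
    (hF : ∀ i y, F i y = (Icc (-c) c).indicator (fun y ↦
        2 * (∫ x, v i x * (Real.cosh (x / 2) : ℂ)) * (Real.cosh (y / 2) : ℂ) -
          2 * (∫ x, v i x * (Real.sinh (x / 2) : ℂ)) * (Real.sinh (y / 2) : ℂ) +
        (∑ n ∈ weilPrimeIndex c, (((ArithmeticFunction.vonMangoldt n : ℝ) / Real.sqrt n : ℝ) : ℂ) *
          (2 * v i y - v i (y - Real.log n) - v i (y + Real.log n))) +
        ∫ t in Ioi 0, (weilArchDensity t : ℂ) * (2 * v i y - v i (y - t) - v i (y + t))) y -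
      (weilMarkovConstant c : ℂ) * v i y)
    (W : Fin k → Fin k → ℝ) (μ : Fin k → ℝ) (lam : ℝ) (hμ : ∀ i, 0 ≤ μ i)
    {n w : ℝ → ℝ} (hnm : Measurable n) (hwm : Measurable w) {C : ℝ} (hnC : ∀ y, |n y| ≤ C) (hwC : ∀ y, |w y| ≤ C)
    (hn0 : ∀ y, 0 ≤ n y) (hw0 : ∀ y, 0 ≤ w y) (hwn : ∀ y, w y * n y = 1)
    (hcert : ∀ φ : ℝ → ℂ, IsWeilTest φ → tsupport φ ⊆ Icc (-c) c → (∀ x, φ (-x) = -φ x) →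
      (∫ y, n y * ‖φ y‖ ^ 2) + lam * ∫ x, ‖φ x‖ ^ 2 ≤
        (weilQuadratic φ).re + ∑ i, μ i * ‖∫ x, φ x * conj (v i x)‖ ^ 2)
    (hPSD : ∀ α : Fin k → ℝ, 0 ≤ ∑ i, ∑ j, α i * α j *
      ((weilPoleForm₂ (v i) (v j) + weilDirichletEnergy₂ c (v i) (v j) -
          weilMarkovConstant c * ∫ x, (v i x * conj (v j x)).re) - lam * (∫ x, (v i x * conj (v j x)).re) -
        ∫ y, w y * ((F i - ∑ l, W i l • v l) y * conj ((F j - ∑ l, W j l • v l) y)).re)) :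
    lam ≤ weilOddGroundEnergy c := by
  refine le_weilOddGroundEnergy_of_forall hc fun φ hφ hφs hφo hφn ↦ ?_
  have h := dt_sector_bound_of_ritz_w hc (-1) g hg (fun i x ↦ by rw [hgo i x]; ring) v F hv hF W μ lam hμ
    hnm hwm hnC hwC hn0 hw0 hwn (fun φ hφ hφs hφp ↦ hcert φ hφ hφs (fun x ↦ by simpa using hφp x)) hPSD hφ hφs
    (fun x ↦ by simpa using hφo x)
  rwa [hφn, mul_one] at h

end Summit.RiemannHypothesis.RiemannHypothesis.Theorems.EvenWinsBeyondArch

end
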